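import Summits.AtomisticToContinuum.HydrodynamicLimit.Theorems.JParityClosureLocalSecondLawLedgerHhat
import Summits.AtomisticToContinuum.HydrodynamicLimit.Theorems.JParityClosureLocalSecondLawLedgerFields

/-!
# Entropy ledger for `JParityClosure.LocalSecondLaw` — the streaming observable `∫ Ĥ(U_r) φ(s, ·)`
(stmt-AtomisticToContinuum-13081, line `exact-entropy-ledger-three-passivities`, layer 8 of stub L)

(Re-landed unchanged in content: the first acceptance's hub build job was lost in a gate restart.)

The time-dependent observable `F(s, w) = ∫ Ĥ(ρ_r(w), m_r(w), e_r(w))(x) φ(s, x) dx` of a configuration `w`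
and its streaming derivative `F'(s, w) = ∫ [(N+1)⁻¹ ∑ᵢ (-∂_{vᵢ} b(xᵢ, x)) (∂_ρĤ + vᵢ·∂_mĤ + ½|vᵢ|²∂_eĤ)(U(x)) φ(s,x)
 + Ĥ(U(x)) ∂ₛφ(s,x)] dx`.  Main result (`hasDerivAt_obs_freeFlight`): along EVERY free flight,
`s ↦ F(s, S_{s-t₀} w)` is differentiable with derivative `F'(s, S_{s-t₀} w)` — differentiation under the integral
sign (`hasDerivAt_integral_of_dominated_loc_of_lip`): the conserved fields are Lipschitz in the flight time
uniformly in the field point and take values in a fixed ball on which the `C¹` function `Ĥ` is Lipschitz, and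
at almost every field point they are differentiable in the flight time (Rademacher, layer 1), where the chain
rule applies.

References: H. Spohn, *Large Scale Dynamics of Interacting Particles* (1991), Part I §3.2.
-/

noncomputable section

namespace Summit.AtomisticToContinuum.HydrodynamicLimit.Theorems.LocalSecondLawLedger

open scoped BigOperators Topology ENNReal InnerProductSpace
open Filter Set MeasureTheory Metric
open Literature.MathematicalPhysics.KineticTheory
open Literature.Analysis.FluidPDE
open Literature.Analysis.FunctionSpaces
open Summit.AtomisticToContinuum.HydrodynamicLimit.Theorems.LocalSecondLawNegative

namespace L

variable {N : ℕ}

/-! ## The conserved variables of a configuration and the observable -/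

/-- The conserved variables `U_r(w)(x) = (ρ_r, m_r, e_r)(x)` of a configuration at a field point. [folklore] -/
def U (r : ℝ) (w : Phase N) (x : T3) : CV := (rhoC r w x, WithLp.ofLp (momC r w x), kinC r w x)

/-- The velocity contraction `∂_ρĤ + v·∂_mĤ + ½|v|² ∂_eĤ` of the derivative of `Ĥ` at `p`. [folklore] -/
def hcoef (σ c η₀ η₁ : ℝ) (p : CV) (v : V3) : ℝ :=
  fderiv ℝ (Hhat σ c η₀ η₁) p (1, 0, 0) + ∑ l, v l * fderiv ℝ (Hhat σ c η₀ η₁) p (0, Pi.single l 1, 0)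
    + ‖v‖ ^ 2 / 2 * fderiv ℝ (Hhat σ c η₀ η₁) p (0, 0, 1)

/-- The observable `F(s, w) = ∫ Ĥ(U_r(w)) φ(s, ·)`. [folklore] -/
def obs (σ c η₀ η₁ r : ℝ) (φ : ℝ → T3 → ℝ) (s : ℝ) (w : Phase N) : ℝ :=
  ∫ x, Hhat σ c η₀ η₁ (U r w x) * φ s x

/-- The streaming integrand of the observable at a field point. [folklore] -/
def obsDi (σ c η₀ η₁ r : ℝ) (φ : ℝ → T3 → ℝ) (s : ℝ) (w : Phase N) (x : T3) : ℝ :=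
  (((N + 1 : ℕ) : ℝ)⁻¹ * ∑ i, -cg r (w i).1 x (w i).2 * hcoef σ c η₀ η₁ (U r w x) (w i).2) * φ s x
    + Hhat σ c η₀ η₁ (U r w x) * deriv (fun s' => φ s' x) s

/-- The streaming derivative `F'(s, w)` of the observable. [folklore] -/
def obsD (σ c η₀ η₁ r : ℝ) (φ : ℝ → T3 → ℝ) (s : ℝ) (w : Phase N) : ℝ :=
  ∫ x, obsDi σ c η₀ η₁ r φ s w x

/-! ## Regularity of the conserved fields of an arbitrary configuration -/

section AnyConfig

variable {r : ℝ} (hr : 0 < r)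
include hr

/-- The conserved fields are continuous in the field point. [folklore] -/
theorem continuous_U (w : Phase N) : Continuous (U r w) :=
  ((exists_lipschitzWith_rhoC hr w).elim fun _ h => h.continuous).prodMk
    ((continuous_pi fun l => (exists_lipschitzWith_momC hr w l).elim fun _ h => h.continuous).prodMk
    ((exists_lipschitzWith_kinC hr w).elim fun _ h => h.continuous))

/-- A uniform bound of the conserved fields along the free flight of a configuration. [folklore] -/
def Ubound (r : ℝ) (w : Phase N) : ℝ :=
  3 / (Real.pi * r ^ 3) * (1 + ((N + 1 : ℕ) : ℝ)⁻¹ * ∑ i, ‖(w i).2‖ + ((N + 1 : ℕ) : ℝ)⁻¹ * ∑ i, ‖(w i).2‖ ^ 2 / 2)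

omit hr in
/-- The bound only depends on the velocities, hence is constant along the free flight. [folklore] -/
theorem Ubound_freeFlight (t : ℝ) (w : Phase N) : Ubound r (freeFlight (Torus.geometry (Fin 3)) t w) = Ubound r w := by
  simp [Ubound]

/-- Velocity-weighted particle averages of the kernel are bounded by the peak times the weight average.
[folklore] -/
theorem abs_cone_avg_le (w : Phase N) (x : T3) (a : Fin (N + 1) → ℝ) :
    |((N + 1 : ℕ) : ℝ)⁻¹ * ∑ i, cone r (w i).1 x * a i| ≤ 3 / (Real.pi * r ^ 3) * (((N + 1 : ℕ) : ℝ)⁻¹ * ∑ i, |a i|) := by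
  rw [abs_mul, abs_of_nonneg (by positivity : (0 : ℝ) ≤ ((N + 1 : ℕ) : ℝ)⁻¹), mul_left_comm, Finset.mul_sum]
  refine mul_le_mul_of_nonneg_left ((Finset.abs_sum_le_sum_abs _ _).trans (Finset.sum_le_sum fun i _ => ?_))
    (by positivity)
  rw [abs_mul]
  exact mul_le_mul_of_nonneg_right (abs_cone_le hr _ _) (abs_nonneg _)

/-- The conserved fields lie in the closed ball of radius `Ubound`. [folklore] -/
theorem norm_U_le (w : Phase N) (x : T3) : ‖U r w x‖ ≤ Ubound r w := by
  have hpk : 0 ≤ 3 / (Real.pi * r ^ 3) := by positivity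
  have h1 : |rhoC r w x| ≤ 3 / (Real.pi * r ^ 3) * 1 := by
    have := abs_cone_avg_le hr w x fun _ => 1
    simp only [mul_one, abs_one, Finset.sum_const, Finset.card_univ, Fintype.card_fin, nsmul_eq_mul] at this
    rw [rhoC_eq_sum]
    simp only [mul_one] at this ⊢
    refine this.trans (le_of_eq ?_)
    field_simp
  have h2 : ∀ l, |momC r w x l| ≤ 3 / (Real.pi * r ^ 3) * (((N + 1 : ℕ) : ℝ)⁻¹ * ∑ i, ‖(w i).2‖) := fun l => by
    rw [momC_apply_eq_sum]
    refine (abs_cone_avg_le hr w x fun i => (w i).2 l).trans (mul_le_mul_of_nonneg_left ?_ hpk)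
    exact mul_le_mul_of_nonneg_left (Finset.sum_le_sum fun i _ => (by simpa only [Real.norm_eq_abs] using PiLp.norm_apply_le (w i).2 l)) (by positivity)
  have h3 : |kinC r w x| ≤ 3 / (Real.pi * r ^ 3) * (((N + 1 : ℕ) : ℝ)⁻¹ * ∑ i, ‖(w i).2‖ ^ 2 / 2) := by
    rw [kinC_eq_sum]
    refine (abs_cone_avg_le hr w x fun i => ‖(w i).2‖ ^ 2 / 2).trans (le_of_eq ?_)
    congr 2
    exact Finset.sum_congr rfl fun i _ => abs_of_nonneg (by positivity)
  have hm : ‖(U r w x).2.1‖ ≤ 3 / (Real.pi * r ^ 3) * (((N + 1 : ℕ) : ℝ)⁻¹ * ∑ i, ‖(w i).2‖) := by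
    refine (pi_norm_le_iff_of_nonneg (by positivity)).2 fun l => ?_
    rw [Real.norm_eq_abs]
    exact h2 l
  unfold Ubound
  rw [mul_add, mul_add]
  have hA : 0 ≤ 3 / (Real.pi * r ^ 3) * (((N + 1 : ℕ) : ℝ)⁻¹ * ∑ i, ‖(w i).2‖) := by positivity
  have hB : 0 ≤ 3 / (Real.pi * r ^ 3) * (((N + 1 : ℕ) : ℝ)⁻¹ * ∑ i, ‖(w i).2‖ ^ 2 / 2) := by positivity
  have h0 : (0 : ℝ) ≤ 3 / (Real.pi * r ^ 3) * 1 := by positivity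
  refine (norm_prod_le_iff.2 ⟨?_, norm_prod_le_iff.2 ⟨?_, ?_⟩⟩)
  · show ‖rhoC r w x‖ ≤ _
    rw [Real.norm_eq_abs]
    linarith [h1]
  · exact hm.trans (by linarith)
  · show ‖kinC r w x‖ ≤ _
    rw [Real.norm_eq_abs]
    exact h3.trans (by linarith)

omit hr in
/-- The distance flown by a particle is at most time times speed. [folklore] -/
theorem dist_flight_le (y : T3) (v : V3) (a b : ℝ) :
    dist (y + Torus.proj (a • v)) (y + Torus.proj (b • v)) ≤ ‖v‖ * |a - b| := by
  rw [dist_eq_norm, add_sub_add_left_eq_sub, ← Torus.proj_sub, ← sub_smul]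
  refine (Torus.norm_proj_le _).trans ?_
  rw [norm_smul, Real.norm_eq_abs, mul_comm]

/-- A velocity-weighted particle average of kernels is Lipschitz in the flight time, uniformly in the field point.
[folklore] -/
theorem abs_cone_avg_flight_sub_le (w : Phase N) (x : T3) (a : Fin (N + 1) → ℝ) (s t : ℝ) :
    |((N + 1 : ℕ) : ℝ)⁻¹ * ∑ i, cone r ((w i).1 + Torus.proj (s • (w i).2)) x * a i
      - ((N + 1 : ℕ) : ℝ)⁻¹ * ∑ i, cone r ((w i).1 + Torus.proj (t • (w i).2)) x * a i|
      ≤ coneLip r * (((N + 1 : ℕ) : ℝ)⁻¹ * ∑ i, ‖(w i).2‖ * |a i|) * |s - t| := by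
  rw [← mul_sub, ← Finset.sum_sub_distrib, abs_mul, abs_of_nonneg (by positivity : (0 : ℝ) ≤ ((N + 1 : ℕ) : ℝ)⁻¹)]
  have hterm : ∀ i, |cone r ((w i).1 + Torus.proj (s • (w i).2)) x * a i
      - cone r ((w i).1 + Torus.proj (t • (w i).2)) x * a i| ≤ coneLip r * (‖(w i).2‖ * |a i|) * |s - t| := by
    intro i
    rw [← sub_mul, abs_mul]
    have h := (lipschitzWith_cone_left hr x).dist_le_mul ((w i).1 + Torus.proj (s • (w i).2))
      ((w i).1 + Torus.proj (t • (w i).2))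
    rw [Real.dist_eq] at h
    calc |cone r ((w i).1 + Torus.proj (s • (w i).2)) x - cone r ((w i).1 + Torus.proj (t • (w i).2)) x| * |a i|
        ≤ coneLip r * (‖(w i).2‖ * |s - t|) * |a i| :=
          mul_le_mul_of_nonneg_right (h.trans (mul_le_mul_of_nonneg_left (dist_flight_le _ _ _ _) (coneLip r).2))
            (abs_nonneg _)
      _ = coneLip r * (‖(w i).2‖ * |a i|) * |s - t| := by ring
  calc ((N + 1 : ℕ) : ℝ)⁻¹ * |∑ i, (cone r ((w i).1 + Torus.proj (s • (w i).2)) x * a i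
        - cone r ((w i).1 + Torus.proj (t • (w i).2)) x * a i)|
      ≤ ((N + 1 : ℕ) : ℝ)⁻¹ * ∑ i, coneLip r * (‖(w i).2‖ * |a i|) * |s - t| :=
        mul_le_mul_of_nonneg_left ((Finset.abs_sum_le_sum_abs _ _).trans (Finset.sum_le_sum fun i _ => hterm i))
          (by positivity)
    _ = coneLip r * (((N + 1 : ℕ) : ℝ)⁻¹ * ∑ i, ‖(w i).2‖ * |a i|) * |s - t| := by
        simp only [Finset.mul_sum, Finset.sum_mul]
        exact Finset.sum_congr rfl fun i _ => by ring

/-- A Lipschitz constant of the conserved fields in the flight time. [folklore] -/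
def ULip (r : ℝ) (w : Phase N) : ℝ :=
  coneLip r * (((N + 1 : ℕ) : ℝ)⁻¹ * ∑ i, ‖(w i).2‖ * 1)
    + coneLip r * (((N + 1 : ℕ) : ℝ)⁻¹ * ∑ i, ‖(w i).2‖ * ‖(w i).2‖)
    + coneLip r * (((N + 1 : ℕ) : ℝ)⁻¹ * ∑ i, ‖(w i).2‖ * (‖(w i).2‖ ^ 2 / 2))

/-- The conserved fields are Lipschitz in the flight time, uniformly in the field point. [folklore] -/
theorem norm_U_flight_sub_le (w : Phase N) (x : T3) (s t : ℝ) :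
    ‖U r (freeFlight (Torus.geometry (Fin 3)) s w) x - U r (freeFlight (Torus.geometry (Fin 3)) t w) x‖
      ≤ ULip r w * |s - t| := by
  have hL0 : 0 ≤ coneLip r * (((N + 1 : ℕ) : ℝ)⁻¹ * ∑ i, ‖(w i).2‖ * 1) * |s - t| := by positivity
  have hL1 : 0 ≤ coneLip r * (((N + 1 : ℕ) : ℝ)⁻¹ * ∑ i, ‖(w i).2‖ * ‖(w i).2‖) * |s - t| := by positivity
  have hL2 : 0 ≤ coneLip r * (((N + 1 : ℕ) : ℝ)⁻¹ * ∑ i, ‖(w i).2‖ * (‖(w i).2‖ ^ 2 / 2)) * |s - t| := by positivity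
  have hρ : |rhoC r (freeFlight (Torus.geometry (Fin 3)) s w) x - rhoC r (freeFlight (Torus.geometry (Fin 3)) t w) x|
      ≤ coneLip r * (((N + 1 : ℕ) : ℝ)⁻¹ * ∑ i, ‖(w i).2‖ * 1) * |s - t| := by
    have h := abs_cone_avg_flight_sub_le hr w x (fun _ => 1) s t
    simp only [rhoC_eq_sum, freeFlight_torus_fst, abs_one, mul_one] at h ⊢
    exact h
  have hm : ∀ l, |momC r (freeFlight (Torus.geometry (Fin 3)) s w) x l - momC r (freeFlight (Torus.geometry (Fin 3)) t w) x l|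
      ≤ coneLip r * (((N + 1 : ℕ) : ℝ)⁻¹ * ∑ i, ‖(w i).2‖ * ‖(w i).2‖) * |s - t| := fun l => by
    have h := abs_cone_avg_flight_sub_le hr w x (fun i => (w i).2 l) s t
    simp only [momC_apply_eq_sum, freeFlight_torus_fst, freeFlight_torus_snd] at h ⊢
    refine h.trans (mul_le_mul_of_nonneg_right (mul_le_mul_of_nonneg_left (mul_le_mul_of_nonneg_left
      (Finset.sum_le_sum fun i _ => mul_le_mul_of_nonneg_left (by simpa only [Real.norm_eq_abs] using PiLp.norm_apply_le (w i).2 l) (norm_nonneg _))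
        (by positivity)) (coneLip r).2) (abs_nonneg _))
  have he : |kinC r (freeFlight (Torus.geometry (Fin 3)) s w) x - kinC r (freeFlight (Torus.geometry (Fin 3)) t w) x|
      ≤ coneLip r * (((N + 1 : ℕ) : ℝ)⁻¹ * ∑ i, ‖(w i).2‖ * (‖(w i).2‖ ^ 2 / 2)) * |s - t| := by
    have h := abs_cone_avg_flight_sub_le hr w x (fun i => ‖(w i).2‖ ^ 2 / 2) s t
    simp only [kinC_eq_sum, freeFlight_torus_fst, freeFlight_torus_snd] at h ⊢
    refine h.trans (le_of_eq ?_)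
    congr 3
    exact Finset.sum_congr rfl fun i _ => by rw [abs_of_nonneg (by positivity)]
  unfold ULip
  rw [add_mul, add_mul]
  refine norm_prod_le_iff.2 ⟨?_, norm_prod_le_iff.2 ⟨?_, ?_⟩⟩
  · simp only [U, Prod.fst_sub, Real.norm_eq_abs]
    linarith [hρ]
  · simp only [U, Prod.snd_sub, Prod.fst_sub]
    refine (pi_norm_le_iff_of_nonneg (by positivity)).2 fun l => ?_
    simp only [Pi.sub_apply, Real.norm_eq_abs]
    linarith [hm l]
  · simp only [U, Prod.snd_sub, Real.norm_eq_abs]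
    linarith [he]

end AnyConfig

/-! ## The conserved fields along the free flight, at a good field point -/

/-- The free-flight time derivative of the conserved fields at a field point (particle form). [folklore] -/
def Udot (r : ℝ) (w : Phase N) (x : T3) : CV :=
  (((N + 1 : ℕ) : ℝ)⁻¹ * ∑ i, -cg r (w i).1 x (w i).2,
    fun l => ((N + 1 : ℕ) : ℝ)⁻¹ * ∑ i, -cg r (w i).1 x (w i).2 * (w i).2 l,
    ((N + 1 : ℕ) : ℝ)⁻¹ * ∑ i, -cg r (w i).1 x (w i).2 * (‖(w i).2‖ ^ 2 / 2))

/-- At a good field point the conserved fields are differentiable along the free flight. [folklore] -/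
theorem hasDerivAt_U_flight {r : ℝ} {w : Phase N} {x : T3}
    (hx : ∀ i, DifferentiableAt ℝ (Torus.liftAt (fun z : T3 => cone r z 0) ((w i).1 - x)) 0) :
    HasDerivAt (fun t : ℝ => U r (freeFlight (Torus.geometry (Fin 3)) t w) x) (Udot r w x) 0 := by
  have hρ : HasDerivAt (fun t : ℝ => rhoC r (freeFlight (Torus.geometry (Fin 3)) t w) x)
      (((N + 1 : ℕ) : ℝ)⁻¹ * ∑ i, -cg r (w i).1 x (w i).2) 0 := by
    have hf : (fun t : ℝ => rhoC r (freeFlight (Torus.geometry (Fin 3)) t w) x) =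
        fun t => ((N + 1 : ℕ) : ℝ)⁻¹ * ∑ i, cone r ((w i).1 + Torus.proj (t • (w i).2)) x := by
      funext t; rw [rhoC_eq_sum]; simp
    rw [hf]
    exact (HasDerivAt.fun_sum fun i _ => hasDerivAt_cone_flight' (hx i)).const_mul _
  have hm : HasDerivAt (fun t : ℝ => WithLp.ofLp (momC r (freeFlight (Torus.geometry (Fin 3)) t w) x))
      (fun l => ((N + 1 : ℕ) : ℝ)⁻¹ * ∑ i, -cg r (w i).1 x (w i).2 * (w i).2 l) 0 := by
    refine hasDerivAt_pi.2 fun l => ?_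
    have hf : (fun t : ℝ => WithLp.ofLp (momC r (freeFlight (Torus.geometry (Fin 3)) t w) x) l) =
        fun t => ((N + 1 : ℕ) : ℝ)⁻¹ * ∑ i, cone r ((w i).1 + Torus.proj (t • (w i).2)) x * (w i).2 l := by
      funext t; rw [momC_apply_eq_sum]; simp
    rw [hf]
    exact (HasDerivAt.fun_sum fun i _ => (hasDerivAt_cone_flight' (hx i)).mul_const _).const_mul _
  have he : HasDerivAt (fun t : ℝ => kinC r (freeFlight (Torus.geometry (Fin 3)) t w) x)
      (((N + 1 : ℕ) : ℝ)⁻¹ * ∑ i, -cg r (w i).1 x (w i).2 * (‖(w i).2‖ ^ 2 / 2)) 0 := by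
    have hf : (fun t : ℝ => kinC r (freeFlight (Torus.geometry (Fin 3)) t w) x) =
        fun t => ((N + 1 : ℕ) : ℝ)⁻¹ * ∑ i, cone r ((w i).1 + Torus.proj (t • (w i).2)) x * (‖(w i).2‖ ^ 2 / 2) := by
      funext t; rw [kinC_eq_sum]; simp
    rw [hf]
    exact (HasDerivAt.fun_sum fun i _ => (hasDerivAt_cone_flight' (hx i)).mul_const _).const_mul _
  exact hρ.prodMk (hm.prodMk he)

/-- The chain rule value: `DĤ(U)·U̇ = (N+1)⁻¹ ∑ᵢ (-∂_{vᵢ}b(xᵢ,·)) (∂_ρĤ + vᵢ·∂_mĤ + ½|vᵢ|²∂_eĤ)(U)`. [folklore] -/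
theorem fderiv_Hhat_Udot (σ c η₀ η₁ r : ℝ) (w : Phase N) (x : T3) (p : CV) :
    fderiv ℝ (Hhat σ c η₀ η₁) p (Udot r w x) =
      ((N + 1 : ℕ) : ℝ)⁻¹ * ∑ i, -cg r (w i).1 x (w i).2 * hcoef σ c η₀ η₁ p (w i).2 := by
  unfold Udot hcoef
  rw [clm_apply_CV]
  simp only [Finset.mul_sum, Finset.sum_mul, mul_add, Finset.sum_add_distrib]
  rw [Finset.sum_comm]
  refine congrArg₂ (· + ·) (congrArg₂ (· + ·) (Finset.sum_congr rfl fun i _ => by ring)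
    (Finset.sum_congr rfl fun i _ => Finset.sum_congr rfl fun l _ => by ring)) (Finset.sum_congr rfl fun i _ => by ring)

/-! ## Differentiation of the observable along every free flight -/

section Streaming

variable {σ c η₀ η₁ r : ℝ} {F : ℝ → ℝ} (hE : EosBand η₀ F) (hη : 0 < η₁) (hη₁ : η₁ < η₀) (hσ : 0 < σ)
  (hc : 0 < c) (hr : 0 < r) {φ : ℝ → T3 → ℝ} (hφ : Torus.IsSmoothSpaceTimeOn Set.univ φ)
include hE hη hη₁ hσ hc hr hφ

/-- The streaming integrand is measurable in the field point. [folklore] -/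
theorem measurable_obsDi (s : ℝ) (w : Phase N) : Measurable (obsDi σ c η₀ η₁ r φ s w) := by
  have hH := contDiff_Hhat hE hη hη₁ hσ hc
  have hfd : Continuous fun x => fderiv ℝ (Hhat σ c η₀ η₁) (U r w x) :=
    (hH.continuous_fderiv one_ne_zero).comp (continuous_U hr w)
  have hco : ∀ v : V3, Continuous fun x => hcoef σ c η₀ η₁ (U r w x) v := fun v => by
    unfold hcoef
    exact ((hfd.clm_apply continuous_const).add (continuous_finsetSum _ fun l _ =>
      continuous_const.mul (hfd.clm_apply continuous_const))).add
        (continuous_const.mul (hfd.clm_apply continuous_const))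
  have hφs : Continuous (φ s) := (hφ.isSmooth_slice (Set.mem_univ s)).continuous
  have hdφ : Continuous fun x => deriv (fun s' => φ s' x) s :=
    (continuous_uncurry_deriv_of_smooth hφ).comp (continuous_const.prodMk continuous_id)
  unfold obsDi
  refine ((measurable_const.mul (Finset.measurable_sum _ fun i _ => ?_)).mul hφs.measurable).add
    ((hH.continuous.comp (continuous_U hr w)).measurable.mul hdφ.measurable)
  exact (measurable_cg r _ _).neg.mul (hco _).measurable

/-- **Differentiation of the observable along the free flight, time origin at the base point.** [folklore] -/
theorem hasDerivAt_obs_shift (w : Phase N) (t : ℝ) :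
    HasDerivAt (fun s => obs σ c η₀ η₁ r φ s (freeFlight (Torus.geometry (Fin 3)) (s - t) w))
      (obsD σ c η₀ η₁ r φ t w) t := by
  have hH := contDiff_Hhat hE hη hη₁ hσ hc
  have hHc : Continuous (Hhat σ c η₀ η₁) := hH.continuous
  set R : ℝ := Ubound r w with hR
  -- `Ĥ` is Lipschitz and bounded on the ball containing all values of the conserved fields
  obtain ⟨KH, hKH⟩ := hH.contDiffOn.exists_lipschitzOnWith one_ne_zero (convex_closedBall (0 : CV) R)
    (isCompact_closedBall (0 : CV) R)
  obtain ⟨B, hB⟩ := (isCompact_closedBall (0 : CV) R).exists_bound_of_continuousOn hHc.continuousOn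
  have hUmem : ∀ (s : ℝ) (x : T3), U r (freeFlight (Torus.geometry (Fin 3)) s w) x ∈ closedBall (0 : CV) R := by
    intro s x
    rw [mem_closedBall, dist_zero_right, hR, ← Ubound_freeFlight (r := r) s w]
    exact norm_U_le hr _ x
  -- the test function is bounded and Lipschitz in time on `[t-1, t+1]`, uniformly in space
  obtain ⟨A, hA⟩ := hφ.exists_norm_le_of_isCompact isCompact_Icc (Set.subset_univ (Set.Icc (t - 1) (t + 1)))
  obtain ⟨M, hM⟩ := exists_time_lipschitz hφ (t - 1) (t + 1)
  have hball : ∀ s ∈ ball t 1, s ∈ Set.Icc (t - 1) (t + 1) := fun s hs => by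
    rw [Real.ball_eq_Ioo] at hs; exact ⟨hs.1.le, hs.2.le⟩
  have hA0 : 0 ≤ A := (norm_nonneg _).trans (hA t ⟨by linarith, by linarith⟩ (Classical.arbitrary T3))
  have hB0 : 0 ≤ B := (norm_nonneg _).trans (hB _ (hUmem 0 (Classical.arbitrary T3)))
  have hM0 : 0 ≤ M := by
    have := hM (Classical.arbitrary T3) t ⟨by linarith, by linarith⟩ (t + 1) ⟨by linarith, by linarith⟩
    rw [add_sub_cancel_left, abs_one, mul_one] at this
    exact (abs_nonneg _).trans this
  -- the Lipschitz estimate in time, uniformly in the field point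
  have h_lip : ∀ x : T3, LipschitzOnWith (Real.nnabs (KH * ULip r w * A + B * M))
      (fun s : ℝ => Hhat σ c η₀ η₁ (U r (freeFlight (Torus.geometry (Fin 3)) (s - t) w) x) * φ s x) (ball t 1) := by
    intro x
    refine LipschitzOnWith.of_dist_le_mul fun s hs s' hs' => ?_
    have h1 := hKH (hUmem (s - t) x) (hUmem (s' - t) x)
    rw [edist_dist, edist_dist, ← ENNReal.ofReal_coe_nnreal, ← ENNReal.ofReal_mul (NNReal.coe_nonneg _),
      ENNReal.ofReal_le_ofReal_iff (by positivity), Real.dist_eq, dist_eq_norm] at h1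
    have h2 := norm_U_flight_sub_le hr w x (s - t) (s' - t)
    rw [show s - t - (s' - t) = s - s' by ring] at h2
    have h3 := hM x s' (hball s' hs') s (hball s hs)
    have h4 : |φ s x| ≤ A := by simpa [Real.norm_eq_abs] using hA s (hball s hs) x
    have h5 : |Hhat σ c η₀ η₁ (U r (freeFlight (Torus.geometry (Fin 3)) (s' - t) w) x)| ≤ B := by
      simpa [Real.norm_eq_abs] using hB _ (hUmem (s' - t) x)
    have hL : 0 ≤ ULip r w := by unfold ULip; positivity
    have hK0 : 0 ≤ (KH : ℝ) * ULip r w * A + B * M :=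
      add_nonneg (mul_nonneg (mul_nonneg (NNReal.coe_nonneg _) hL) hA0) (mul_nonneg hB0 hM0)
    rw [Real.dist_eq, Real.dist_eq, Real.coe_nnabs, abs_of_nonneg hK0]
    calc |Hhat σ c η₀ η₁ (U r (freeFlight (Torus.geometry (Fin 3)) (s - t) w) x) * φ s x
          - Hhat σ c η₀ η₁ (U r (freeFlight (Torus.geometry (Fin 3)) (s' - t) w) x) * φ s' x|
        = |(Hhat σ c η₀ η₁ (U r (freeFlight (Torus.geometry (Fin 3)) (s - t) w) x)
            - Hhat σ c η₀ η₁ (U r (freeFlight (Torus.geometry (Fin 3)) (s' - t) w) x)) * φ s x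
            + Hhat σ c η₀ η₁ (U r (freeFlight (Torus.geometry (Fin 3)) (s' - t) w) x) * (φ s x - φ s' x)| := by
          ring_nf
      _ ≤ |Hhat σ c η₀ η₁ (U r (freeFlight (Torus.geometry (Fin 3)) (s - t) w) x)
            - Hhat σ c η₀ η₁ (U r (freeFlight (Torus.geometry (Fin 3)) (s' - t) w) x)| * |φ s x|
            + |Hhat σ c η₀ η₁ (U r (freeFlight (Torus.geometry (Fin 3)) (s' - t) w) x)| * |φ s x - φ s' x| := by
          refine (abs_add_le _ _).trans ?_; rw [abs_mul, abs_mul]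
      _ ≤ (KH * (ULip r w * |s - s'|)) * A + B * (M * |s - s'|) := by
          gcongr
          · exact h1.trans (mul_le_mul_of_nonneg_left h2 (NNReal.coe_nonneg _))
      _ = (KH * ULip r w * A + B * M) * |s - s'| := by ring
  -- the pointwise derivative at almost every field point
  have h_diff : ∀ᵐ x : T3, HasDerivAt
      (fun s : ℝ => Hhat σ c η₀ η₁ (U r (freeFlight (Torus.geometry (Fin 3)) (s - t) w) x) * φ s x)
      (obsDi σ c η₀ η₁ r φ t w x) t := by
    filter_upwards [ae_differentiableAt_cone hr w] with x hx
    have hU0 := hasDerivAt_U_flight hx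
    have hU0' : HasDerivAt (fun t : ℝ => U r (freeFlight (Torus.geometry (Fin 3)) t w) x) (Udot r w x) (t - t) := by
      rw [sub_self]; exact hU0
    have hU : HasDerivAt (fun s : ℝ => U r (freeFlight (Torus.geometry (Fin 3)) (s - t) w) x) (Udot r w x) t :=
      hU0'.comp_sub_const t t
    have hpt : U r (freeFlight (Torus.geometry (Fin 3)) (t - t) w) x = U r w x := by
      rw [sub_self, freeFlight_zero]
    have hHU := ((hH.differentiable one_ne_zero _).hasFDerivAt.comp_hasDerivAt t hU)
    rw [hpt] at hHU
    have hprod := hHU.mul (hasDerivAt_time_slice hφ t x)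
    refine hprod.congr_deriv ?_
    simp only [Function.comp_apply, hpt, obsDi, fderiv_Hhat_Udot]
  -- differentiation under the integral sign
  have hφs : ∀ s, Continuous (φ s) := fun s => (hφ.isSmooth_slice (Set.mem_univ s)).continuous
  have hcontF : ∀ s, Continuous fun x => Hhat σ c η₀ η₁ (U r (freeFlight (Torus.geometry (Fin 3)) (s - t) w) x) * φ s x :=
    fun s => (hHc.comp (continuous_U hr _)).mul (hφs s)
  have key := hasDerivAt_integral_of_dominated_loc_of_lip (μ := (volume : Measure T3))
    (F := fun (s : ℝ) (x : T3) => Hhat σ c η₀ η₁ (U r (freeFlight (Torus.geometry (Fin 3)) (s - t) w) x) * φ s x)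
    (x₀ := t) (s := ball t 1) (bound := fun _ => KH * ULip r w * A + B * M)
    (F' := obsDi σ c η₀ η₁ r φ t w) (ball_mem_nhds _ one_pos)
    (Filter.Eventually.of_forall fun s => (hcontF s).aestronglyMeasurable)
    (integrable_of_continuous_T3 (hcontF t))
    (measurable_obsDi hE hη hη₁ hσ hc hr hφ t w).aestronglyMeasurable
    (Filter.Eventually.of_forall h_lip) (integrable_const _) h_diff
  exact key.2

/-- **Differentiation of the observable along every free flight** (arbitrary time origin): the streaming
hypothesis of the weak balance law. [folklore] -/
theorem hasDerivAt_obs_freeFlight (w : Phase N) (t₀ t : ℝ) :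
    HasDerivAt (fun s => obs σ c η₀ η₁ r φ s (freeFlight (Torus.geometry (Fin 3)) (s - t₀) w))
      (obsD σ c η₀ η₁ r φ t (freeFlight (Torus.geometry (Fin 3)) (t - t₀) w)) t := by
  have h := hasDerivAt_obs_shift hE hη hη₁ hσ hc hr hφ (freeFlight (Torus.geometry (Fin 3)) (t - t₀) w) t
  refine h.congr_of_eventuallyEq (Filter.Eventually.of_forall fun s => ?_)
  show obs σ c η₀ η₁ r φ s (freeFlight (Torus.geometry (Fin 3)) (s - t₀) w) =
    obs σ c η₀ η₁ r φ s (freeFlight (Torus.geometry (Fin 3)) (s - t) (freeFlight (Torus.geometry (Fin 3)) (t - t₀) w))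
  rw [← freeFlight_add]
  congr 2
  ring

end Streaming

end L

/-- **Registered sub-goal `ledgerL_obs`** of stub `stub_ledger` (line `exact-entropy-ledger-three-passivities`):
The observable streams differentiably along every free flight (first hypothesis of the weak balance law). [folklore] -/
theorem ledgerL_obs :
  ∀ {N : ℕ} {σ c η₀ η₁ r : ℝ} {F : ℝ → ℝ}, EosBand η₀ F → 0 < η₁ → η₁ < η₀ → 0 < σ → 0 < c → 0 < r → ∀ {φ : ℝ → T3 → ℝ}, Literature.Analysis.FunctionSpaces.Torus.IsSmoothSpaceTimeOn Set.univ φ → ∀ (w : Phase N) (t₀ t : ℝ), HasDerivAt (fun s => L.obs σ c η₀ η₁ r φ s (freeFlight (Torus.geometry (Fin 3)) (s - t₀) w)) (L.obsD σ c η₀ η₁ r φ t (freeFlight (Torus.geometry (Fin 3)) (t - t₀) w)) t := by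
  intro N σ c η₀ η₁ r F hE hη hη₁ hσ hc hr φ hφ w t₀ t
  exact L.hasDerivAt_obs_freeFlight hE hη hη₁ hσ hc hr hφ w t₀ t

end Summit.AtomisticToContinuum.HydrodynamicLimit.Theorems.LocalSecondLawLedger

end
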